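import Mathlib.GroupTheory.Finiteness
import Mathlib.Algebra.Group.Submonoid.BigOperators
import Mathlib.Algebra.Order.BigOperators.Group.Finset
import Mathlib.Algebra.BigOperators.Fin
import Mathlib.Algebra.Module.NatInt
import Mathlib.Algebra.Module.BigOperators
import HarnessLib

/-!
# A finitely generated ℕ-graded commutative monoid has a standard Veronese level (engine for Herzog–Hibi–Trung 2007, Thm. 2.1 (a) ⇒ (b))

Topic: `Literature/RingTheory/MvPolynomial` (engine (B) of the discharge of the named fact
`Literature.RingTheory.MvPolynomial.HerzogHibiTrung2007_Cor2_2`, `MonomialIdealPowersVeronese.lean`; route posted by seat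
res-type-010, cell `res-hironaka` 2026-08-27T03:49:46Z; this file by seat res-L1-s36-pv-2). Pure additive combinatorics, no rings.

Let `M` be a finitely generated commutative (additive) monoid with a degree `deg : M →+ ℕ`. Then there is a level `e > 0` such that
**every element of degree `k·e` (`k ≥ 1`) is a sum of `k` elements of degree `e`** (`AddMonoid.FG.exists_veronese_level`) — i.e. the
`e`-th Veronese of `M` is «standard graded» (generated in its degree one). This is the monoid form of [HerzogHibiTrung2007, Thm. 2.1,
(a) ⇒ (b)] («(a) A is a finitely generated S-algebra ⇒ (b) there exists an integer d such that A^{(d)} is a standard graded S-algebra»;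
classical: Bourbaki, *Algèbre commutative* III §1 no. 3 Prop. 3; EGA II (2.1.6)). Proof: let `g_1, …, g_s` be the generators of
POSITIVE degree `d_i`, `m := ∏ d_i`, `e := (s+1)·m`; write an element of degree `k e` as `Σ a_i g_i + (degree-0 part)`; while the
remaining positive degree is `≥ s·m`, pigeonhole gives an `i` with `a_i d_i ≥ m`, so a block `(m/d_i)·g_i` of degree exactly `m` can be
peeled off (`exists_le_sum_mul_eq`); `s+1` peels give a sub-sum of degree exactly `e`, and `(k e) − (s−1) m ≥ s m` keeps the peeling
alive as long as `k ≥ 2` (`exists_blocks`); the degree-0 part is absorbed into the first block.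
-/

namespace Literature.RingTheory.MvPolynomial

open Finset

/-! ## Peeling blocks of degree `m` off a coefficient vector -/

/-- **Peeling.** Let `d_i > 0` divide `m` for `i ∈ s` (`s` non-empty). If `Σ_{i ∈ s} a_i d_i ≥ n·m + (|s| − 1)·m` then some
`b ≤ a` has `Σ_{i ∈ s} b_i d_i = n·m` exactly (pigeonhole: a summand `a_i d_i ≥ m` exists as long as the total is `≥ |s|·m`; peel
`m/d_i` copies of `i` and recurse). [cite: HerzogHibiTrung2007, Thm. 2.1 (proof, (a) ⇒ (b))] -/
theorem exists_le_sum_mul_eq {ι : Type*} [DecidableEq ι] (s : Finset ι) (hs : s.Nonempty) (d : ι → ℕ) (m : ℕ)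
    (hd : ∀ i ∈ s, 0 < d i) (hm : ∀ i ∈ s, d i ∣ m) :
    ∀ (n : ℕ) (a : ι → ℕ), n * m + (s.card - 1) * m ≤ ∑ i ∈ s, a i * d i →
      ∃ b : ι → ℕ, b ≤ a ∧ ∑ i ∈ s, b i * d i = n * m := by
  intro n
  induction n with
  | zero =>
    intro a _
    exact ⟨0, fun _ => Nat.zero_le _, by simp⟩
  | succ n ih =>
    intro a ha
    have hc : 1 ≤ s.card := hs.card_pos
    -- pigeonhole: some `i ∈ s` has `m ≤ a i * d i`
    have hcard : ∑ _i ∈ s, m ≤ ∑ i ∈ s, a i * d i := by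
      rw [Finset.sum_const, smul_eq_mul]
      have h1 : s.card * m = (s.card - 1) * m + m := by
        rw [← Nat.succ_mul]
        congr 1
        omega
      have h2 : (s.card - 1) * m + m ≤ (n + 1) * m + (s.card - 1) * m := by
        rw [Nat.succ_mul]
        omega
      omega
    obtain ⟨i, hi, hmi⟩ := Finset.exists_le_of_sum_le hs hcard
    obtain ⟨q, hq⟩ := hm i hi
    -- `q = m / d i ≤ a i`
    have hqa : q ≤ a i := by
      have h1 : q * d i ≤ a i * d i := by
        rw [mul_comm, ← hq]
        exact hmi
      exact Nat.le_of_mul_le_mul_right h1 (hd i hi)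
    -- peel: `a' := a` with `a' i := a i - q`
    set a' : ι → ℕ := Function.update a i (a i - q) with ha'
    have hsplit : ∀ f : ι → ℕ, ∑ j ∈ s, f j * d j = f i * d i + ∑ j ∈ s.erase i, f j * d j :=
      fun f => (Finset.add_sum_erase s (fun j => f j * d j) hi).symm
    have herase : ∑ j ∈ s.erase i, a' j * d j = ∑ j ∈ s.erase i, a j * d j := by
      refine Finset.sum_congr rfl fun j hj => ?_
      rw [ha', Function.update_of_ne (Finset.ne_of_mem_erase hj)]
    have ha'i : a' i = a i - q := by rw [ha', Function.update_self]
    have hsum' : ∑ j ∈ s, a' j * d j + m = ∑ j ∈ s, a j * d j := by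
      rw [hsplit a', hsplit a, herase, ha'i, hq]
      have : (a i - q) * d i + d i * q = a i * d i := by
        rw [mul_comm (d i) q, ← Nat.add_mul, Nat.sub_add_cancel hqa]
      omega
    have ha'' : n * m + (s.card - 1) * m ≤ ∑ j ∈ s, a' j * d j := by
      rw [Nat.succ_mul] at ha
      omega
    obtain ⟨b', hb'le, hb'sum⟩ := ih a' ha''
    refine ⟨Function.update b' i (b' i + q), fun j => ?_, ?_⟩
    · by_cases hj : j = i
      · rw [hj, Function.update_self]
        have h1 : b' i ≤ a' i := hb'le i
        rw [ha'i] at h1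
        exact (Nat.le_sub_iff_add_le hqa).mp h1
      · rw [Function.update_of_ne hj]
        have := hb'le j
        rw [ha', Function.update_of_ne hj] at this
        exact this
    · rw [hsplit, Function.update_self, Nat.succ_mul, ← hb'sum, hsplit b']
      have herase' : ∑ j ∈ s.erase i, Function.update b' i (b' i + q) j * d j = ∑ j ∈ s.erase i, b' j * d j := by
        refine Finset.sum_congr rfl fun j hj => ?_
        rw [Function.update_of_ne (Finset.ne_of_mem_erase hj)]
      rw [herase', Nat.add_mul, mul_comm q (d i), ← hq]
      omega

/-- **Blocks.** With `e := (|s| + 1)·m`: a coefficient vector of weighted degree `(k+1)·e` splits into `k+1` coefficient vectors of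
weighted degree exactly `e`. [cite: HerzogHibiTrung2007, Thm. 2.1 (proof, (a) ⇒ (b))] -/
theorem exists_blocks {ι : Type*} [DecidableEq ι] (s : Finset ι) (d : ι → ℕ) (m : ℕ) (hmpos : 0 < m)
    (hd : ∀ i ∈ s, 0 < d i) (hm : ∀ i ∈ s, d i ∣ m) :
    ∀ (k : ℕ) (a : ι → ℕ), ∑ i ∈ s, a i * d i = (k + 1) * ((s.card + 1) * m) →
      ∃ as : Fin (k + 1) → ι → ℕ, (∀ j, ∑ i ∈ s, as j i * d i = (s.card + 1) * m) ∧ ∀ i, ∑ j, as j i = a i := by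
  intro k
  induction k with
  | zero =>
    intro a ha
    refine ⟨fun _ => a, fun _ => by rw [ha, zero_add, one_mul], fun i => by simp⟩
  | succ k ih =>
    intro a ha
    have hs : s.Nonempty := by
      rw [Finset.nonempty_iff_ne_empty]
      rintro rfl
      rw [Finset.sum_empty, Finset.card_empty] at ha
      have : 0 < (k + 1 + 1) * ((0 + 1) * m) := Nat.mul_pos (Nat.succ_pos _) (by simpa using hmpos)
      omega
    -- peel one block of degree `e = (|s|+1)·m`
    have hroom : (s.card + 1) * m + (s.card - 1) * m ≤ ∑ i ∈ s, a i * d i := by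
      rw [ha]
      have hc : 1 ≤ s.card := hs.card_pos
      have h1 : (s.card + 1) * m + (s.card - 1) * m = 2 * (s.card * m) := by
        have : (s.card - 1) * m + m = s.card * m := by
          rw [← Nat.succ_mul]; congr 1; omega
        rw [Nat.succ_mul]
        omega
      rw [h1]
      have h2 : 2 * (s.card * m) ≤ (k + 1 + 1) * (s.card * m) := Nat.mul_le_mul_right _ (by omega)
      refine h2.trans ?_
      rw [Nat.succ_mul (s.card) m, Nat.mul_add]
      omega
    obtain ⟨b, hble, hbsum⟩ := exists_le_sum_mul_eq s hs d m hd hm (s.card + 1) a hroom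
    -- the rest `a - b` has degree `(k+1)·e`
    have hrest : ∑ i ∈ s, (a i - b i) * d i = (k + 1) * ((s.card + 1) * m) := by
      have h1 : ∑ i ∈ s, (a i - b i) * d i + ∑ i ∈ s, b i * d i = ∑ i ∈ s, a i * d i := by
        rw [← Finset.sum_add_distrib]
        refine Finset.sum_congr rfl fun i _ => ?_
        rw [← Nat.add_mul, Nat.sub_add_cancel (hble i)]
      rw [hbsum, ha, Nat.succ_mul (k + 1)] at h1
      omega
    obtain ⟨as', has'deg, has'sum⟩ := ih (fun i => a i - b i) hrest
    refine ⟨Fin.cons b as', fun j => ?_, fun i => ?_⟩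
    · refine Fin.cases ?_ (fun j => ?_) j
      · simpa using hbsum
      · simpa using has'deg j
    · rw [Fin.sum_univ_succ]
      simp only [Fin.cons_zero, Fin.cons_succ]
      rw [has'sum i, Nat.add_sub_cancel' (hble i)]

/-! ## The Veronese level of a finitely generated graded monoid -/

/-- **A finitely generated ℕ-graded commutative monoid has a standard Veronese level**: there is `e > 0` such that every element of
degree `k·e`, `k ≥ 1`, is a sum of `k` elements of degree `e` (generators of degree `0` are allowed; they are absorbed into the first
summand, whence `k ≥ 1`). Monoid form of Herzog–Hibi–Trung Thm. 2.1 (a) ⇒ (b) (Bourbaki AC III §1 no. 3; EGA II (2.1.6)).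
[cite: HerzogHibiTrung2007, Thm. 2.1 ((a) ⇒ (b))] -/
theorem AddMonoid.FG.exists_veronese_level {M : Type*} [AddCommMonoid M] [hM : AddMonoid.FG M] (deg : M →+ ℕ) :
    ∃ e : ℕ, 0 < e ∧ ∀ k : ℕ, 0 < k → ∀ x : M, deg x = k * e →
      ∃ xs : Fin k → M, (∀ i, deg (xs i) = e) ∧ x = ∑ i, xs i := by
  classical
  obtain ⟨S, hS⟩ := AddMonoid.fg_def.mp hM
  -- positive-degree generators, the product of their degrees, the level
  set Sp : Finset M := S.filter fun g => 0 < deg g with hSp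
  set m : ℕ := ∏ g ∈ Sp, deg g with hmdef
  have hmpos : 0 < m := Finset.prod_pos fun g hg => (Finset.mem_filter.mp hg).2
  have hdpos : ∀ g ∈ Sp, 0 < deg g := fun g hg => (Finset.mem_filter.mp hg).2
  have hdvd : ∀ g ∈ Sp, deg g ∣ m := fun g hg => Finset.dvd_prod_of_mem _ hg
  refine ⟨(Sp.card + 1) * m, Nat.mul_pos (Nat.succ_pos _) hmpos, fun k hk x hx => ?_⟩
  obtain ⟨k, rfl⟩ : ∃ k', k = k' + 1 := ⟨k - 1, (Nat.sub_add_cancel hk).symm⟩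
  -- write `x` on the generators
  have hxS : x ∈ AddSubmonoid.closure (S : Set M) := by rw [hS]; exact AddSubmonoid.mem_top x
  obtain ⟨f, -, hfx⟩ := AddSubmonoid.mem_closure_finset.mp hxS
  -- degree bookkeeping: the degree lives on `Sp`
  have hdeg0 : ∀ g ∈ S.filter (fun g => ¬ 0 < deg g), deg g = 0 := fun g hg => by
    have := (Finset.mem_filter.mp hg).2
    omega
  have hdegsum : ∑ g ∈ Sp, f g * deg g = (k + 1) * ((Sp.card + 1) * m) := by
    rw [← hx, ← hfx, map_sum]
    simp_rw [map_nsmul, smul_eq_mul]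
    rw [← Finset.sum_filter_add_sum_filter_not S (fun g => 0 < deg g)]
    have h0 : ∑ g ∈ S.filter (fun g => ¬ 0 < deg g), f g * deg g = 0 :=
      Finset.sum_eq_zero fun g hg => by rw [hdeg0 g hg, mul_zero]
    rw [h0, add_zero]
  obtain ⟨as, hasdeg, hassum⟩ := exists_blocks Sp (fun g => deg g) m hmpos hdpos hdvd k f hdegsum
  -- the degree-0 part, absorbed into block `0`
  set x₀ : M := ∑ g ∈ S.filter (fun g => ¬ 0 < deg g), f g • g with hx₀
  have hdegx₀ : deg x₀ = 0 := by
    rw [hx₀, map_sum]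
    exact Finset.sum_eq_zero fun g hg => by rw [map_nsmul, hdeg0 g hg, smul_zero]
  refine ⟨fun j => (∑ g ∈ Sp, as j g • g) + if j = 0 then x₀ else 0, fun j => ?_, ?_⟩
  · rw [map_add, map_sum]
    simp_rw [map_nsmul, smul_eq_mul]
    rw [hasdeg j]
    split_ifs
    · rw [hdegx₀, add_zero]
    · rw [map_zero, add_zero]
  · rw [Finset.sum_add_distrib, Finset.sum_ite_eq' Finset.univ (0 : Fin (k + 1)) (fun _ => x₀), if_pos (Finset.mem_univ _),
      Finset.sum_comm]
    have h1 : ∑ g ∈ Sp, ∑ j : Fin (k + 1), as j g • g = ∑ g ∈ Sp, f g • g := by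
      refine Finset.sum_congr rfl fun g _ => ?_
      rw [← Finset.sum_smul, hassum g]
    rw [h1, hx₀, hSp, Finset.sum_filter_add_sum_filter_not S (fun g => 0 < deg g) (fun g => f g • g), hfx]

end Literature.RingTheory.MvPolynomial
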